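import Summits.Ventures.PercRepro.Night2LocalCover

/-!
# PercRepro — the local form at a flat with a single carrying hyperplane, and the diagonal `q = 1` (night-2, gen 6)

Two further regimes of the local form `LocalShadowHall M q G` (`Night2LocalForm.lean`) are closed here:

* **`localShadowHall_of_single`**: if all bottom sets with closure inside `G` have the SAME closure `F`, then
  `LocalShadowHall M q G` — the sets `B ∪ {z}` (`z ∈ G ∖ F`) are pairwise distinct (`B = S ∩ F`), so
  `#shadowAt ≥ Σ_B |G ∖ F|`, while each local weight is `|G ∖ F| / |E ∖ F| ≤ |G ∖ F| / 2`;
* **`clF_eq_of_card_compl_two`**: a carrying hyperplane `F` with exactly TWO ground elements outside it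
  (`E ∖ F = {z, w}`, `z ∈ G`, `w ∉ G`) is the only carrying hyperplane of `G`: a bottom set `B ⊆ G` with
  `cl B ≠ F` contains `z`, so `E ∖ B ⊆ F ∪ {w}` has rank `≤ q + 1`;
* hence **`localShadowHall_of_exists_two`** (`LocalShadowHall M q G` whenever some carrying hyperplane has
  `|E ∖ F| = 2`), and, since at `q = 1` a carrying hyperplane is either thin (`|E ∖ F| ≥ 3 = q + 2`) or has
  `|E ∖ F| = 2`, **`localShadowHall_one`**: the local form holds at every line of every finite matroid;
* **`shadowHall_three_one`**: `ShadowHall M 3 1 (phiK 3 1)` for EVERY finite matroid — the diagonal shadow form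
  of C-025 at `q = 1` (every sub-family of the bottom sets `Uq M 3 1` has at least `3/2 · #𝒜` middle-level
  sets above it), by `shadowHall_of_local`.
-/

namespace PercRepro.Shadow

open Finset PerFlat ThmH

variable {α : Type*} [DecidableEq α] {M : Matroid α} [M.Finite]

/-! ## A single carrying hyperplane -/

/-- Two rank-`q` flats, one inside the other, are equal. -/
theorem flatsQ_eq_of_subset {q : ℕ} {F F' : Finset α} (hF : F ∈ flatsQ M q) (hF' : F' ∈ flatsQ M q)
    (h : F ⊆ F') : F = F' := by
  rw [mem_flatsQ] at hF hF'
  by_contra hne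
  obtain ⟨g, hgF', hgF⟩ := Finset.exists_of_ssubset (lt_of_le_of_ne h hne)
  have hgE : g ∈ M.E \ M.closure (F : Set α) := by
    refine ⟨by rw [← coe_gr]; exact_mod_cast hF'.1 hgF', ?_⟩
    rw [hF.2.1.closure]
    exact_mod_cast hgF
  have h1 : M.eRk ((insert g F : Finset α) : Set α) = ((q + 1 : ℕ) : ℕ∞) := by
    rw [Finset.coe_insert, Matroid.eRk_insert_eq_add_one hgE, hF.2.2]
    push_cast
    rfl
  have h2 : M.eRk ((insert g F : Finset α) : Set α) ≤ (q : ℕ∞) := by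
    rw [← hF'.2.2]
    exact M.eRk_mono (by exact_mod_cast Finset.insert_subset hgF' h)
  rw [h1] at h2
  have : q + 1 ≤ q := by exact_mod_cast h2
  omega

open scoped Classical in
/-- **The local form at a flat with a single carrying hyperplane.**  If every bottom set with closure inside `G`
has closure `F`, then `LocalShadowHall M q G`. -/
theorem localShadowHall_of_single {q : ℕ} {G : Finset α} (hG : G ∈ flatsQ M (q + 1)) {F : Finset α}
    (hsame : ∀ B ∈ Uq M (q + 2) q, clF M B ⊆ G → clF M B = F) : LocalShadowHall M q G := by
  intro 𝒜 h𝒜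
  have hq1 : (0 : ℚ) < (q : ℚ) + 1 := by positivity
  -- the pairs (B, z) with B ∈ membersIn, z ∈ G ∖ F inject into shadowAt via (B, z) ↦ insert z B
  set P : Finset (Σ _ : Finset α, α) := (membersIn M 𝒜 G).sigma (fun B => G \ clF M B) with hP
  let f : (Σ _ : Finset α, α) → Finset α := fun x => insert x.2 x.1
  have hmemP : ∀ x ∈ P, x.1 ∈ membersIn M 𝒜 G ∧ x.2 ∈ G \ clF M x.1 := by
    intro x hx
    rw [hP, Finset.mem_sigma] at hx
    exact hx
  have hclF : ∀ x ∈ P, clF M x.1 = F := by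
    intro x hx
    obtain ⟨hx1, -⟩ := hmemP x hx
    rw [mem_membersIn] at hx1
    exact hsame x.1 (h𝒜 hx1.1) hx1.2
  have hPcard : P.card = ∑ B ∈ membersIn M 𝒜 G, (G \ clF M B).card := by
    rw [hP, Finset.card_sigma]
  have hinj : Set.InjOn f (P : Set (Σ _ : Finset α, α)) := by
    intro x hx y hy hxy
    rw [Finset.mem_coe] at hx hy
    obtain ⟨hx1, hx2⟩ := hmemP x hx
    obtain ⟨hy1, hy2⟩ := hmemP y hy
    have hxF := hclF x hx
    have hyF := hclF y hy
    have hxB : x.1 ⊆ F := by rw [← hxF]; exact subset_clF (h𝒜 (mem_membersIn.1 hx1).1)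
    have hyB : y.1 ⊆ F := by rw [← hyF]; exact subset_clF (h𝒜 (mem_membersIn.1 hy1).1)
    have hxz : x.2 ∉ F := by rw [← hxF]; exact (Finset.mem_sdiff.1 hx2).2
    have hyz : y.2 ∉ F := by rw [← hyF]; exact (Finset.mem_sdiff.1 hy2).2
    have hxy' : insert x.2 x.1 = insert y.2 y.1 := hxy
    -- z = z'
    have hz : x.2 = y.2 := by
      have : x.2 ∈ insert y.2 y.1 := by rw [← hxy']; exact Finset.mem_insert_self _ _
      rw [Finset.mem_insert] at this
      rcases this with h | h
      · exact h
      · exact absurd (hyB h) hxz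
    have hxB' : x.2 ∉ x.1 := fun h => hxz (hxB h)
    have hyB' : y.2 ∉ y.1 := fun h => hyz (hyB h)
    have h1 : x.1 = y.1 := by
      calc x.1 = (insert x.2 x.1).erase x.2 := (Finset.erase_insert hxB').symm
        _ = (insert y.2 y.1).erase y.2 := by rw [hxy', hz]
        _ = y.1 := Finset.erase_insert hyB'
    exact Sigma.ext h1 (heq_of_eq hz)
  have himg : P.image f ⊆ shadowAt M (q + 2) q 𝒜 G := by
    intro S hS
    rw [Finset.mem_image] at hS
    obtain ⟨x, hx, rfl⟩ := hS
    obtain ⟨hx1, hx2⟩ := hmemP x hx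
    exact insert_mem_shadowAt h𝒜 hG hx1 hx2
  have hcount : ∑ B ∈ membersIn M 𝒜 G, (G \ clF M B).card ≤ (shadowAt M (q + 2) q 𝒜 G).card := by
    rw [← hPcard, ← Finset.card_image_of_injOn hinj]
    exact Finset.card_le_card himg
  -- each local weight is at most |G ∖ cl B| / 2
  have hw : ∀ B ∈ membersIn M 𝒜 G, localWeight M B G ≤ ((G \ clF M B).card : ℚ) / 2 := by
    intro B hB
    rw [mem_membersIn] at hB
    have h2 := two_le_card_compl_clF (h𝒜 hB.1)
    have h2' : (2 : ℚ) ≤ ((gr M \ clF M B).card : ℚ) := by exact_mod_cast h2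
    unfold localWeight
    exact div_le_div_of_nonneg_left (by positivity) (by norm_num) h2'
  have hcount' : (∑ B ∈ membersIn M 𝒜 G, ((G \ clF M B).card : ℚ)) ≤
      ((shadowAt M (q + 2) q 𝒜 G).card : ℚ) := by exact_mod_cast hcount
  have hratio : ((q : ℚ) + 2) / ((q : ℚ) + 1) ≤ 2 := by
    rw [div_le_iff₀ hq1]; linarith
  calc (((q : ℚ) + 2) / ((q : ℚ) + 1)) * ∑ B ∈ membersIn M 𝒜 G, localWeight M B G
      ≤ 2 * ∑ B ∈ membersIn M 𝒜 G, ((G \ clF M B).card : ℚ) / 2 := by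
        apply mul_le_mul hratio (Finset.sum_le_sum hw) ?_ (by norm_num)
        apply Finset.sum_nonneg
        intro B _
        unfold localWeight
        positivity
    _ = ∑ B ∈ membersIn M 𝒜 G, ((G \ clF M B).card : ℚ) := by
        rw [← Finset.sum_div]
        ring
    _ ≤ ((shadowAt M (q + 2) q 𝒜 G).card : ℚ) := hcount'

/-! ## A carrying hyperplane with two elements outside is the only one -/

/-- If `B₀ ∈ Uq M (q+2) q` has closure inside `G` with exactly two ground elements outside its closure, then every
bottom set with closure inside `G` has the same closure. -/
theorem clF_eq_of_card_compl_two {q : ℕ} {G : Finset α} (hG : G ∈ flatsQ M (q + 1)) {B₀ : Finset α}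
    (hB₀ : B₀ ∈ Uq M (q + 2) q) (hB₀G : clF M B₀ ⊆ G) (h2 : (gr M \ clF M B₀).card = 2)
    {B : Finset α} (hB : B ∈ Uq M (q + 2) q) (hBG : clF M B ⊆ G) : clF M B = clF M B₀ := by
  set F := clF M B₀ with hF
  have hFq : F ∈ flatsQ M q := clF_mem_flatsQ hB₀
  have hBq : clF M B ∈ flatsQ M q := clF_mem_flatsQ hB
  have hGg : G ⊆ gr M := (mem_flatsQ.1 hG).1
  -- G ∖ F is nonempty (rank q < q + 1)
  have hGF : (G \ F).Nonempty := by
    rw [Finset.nonempty_iff_ne_empty]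
    intro hempty
    have hsub : G ⊆ F := by
      intro g hg
      by_contra hgF
      have : g ∈ G \ F := Finset.mem_sdiff.2 ⟨hg, hgF⟩
      rw [hempty] at this
      exact Finset.notMem_empty _ this
    have hGq : M.eRk (G : Set α) ≤ (q : ℕ∞) := by
      rw [← (mem_flatsQ.1 hFq).2.2]
      exact M.eRk_mono (by exact_mod_cast hsub)
    rw [(mem_flatsQ.1 hG).2.2] at hGq
    have : q + 1 ≤ q := by exact_mod_cast hGq
    omega
  -- E ∖ G is nonempty (the complement of B₀ has rank q + 2 > q + 1)
  have hEG : (gr M \ G).Nonempty := by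
    rw [Finset.nonempty_iff_ne_empty]
    intro hempty
    have hsub : gr M ⊆ G := by
      intro g hg
      by_contra hgG
      have : g ∈ gr M \ G := Finset.mem_sdiff.2 ⟨hg, hgG⟩
      rw [hempty] at this
      exact Finset.notMem_empty _ this
    have hr : M.eRk ((gr M \ B₀ : Finset α) : Set α) ≤ ((q + 1 : ℕ) : ℕ∞) := by
      rw [← (mem_flatsQ.1 hG).2.2]
      exact M.eRk_mono (by exact_mod_cast Finset.sdiff_subset.trans hsub)
    rw [(mem_Uq.1 hB₀).2.2] at hr
    have : q + 2 ≤ q + 1 := by exact_mod_cast hr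
    omega
  obtain ⟨z, hz⟩ := hGF
  obtain ⟨w, hw⟩ := hEG
  have hzF : z ∈ gr M \ F := Finset.mem_sdiff.2 ⟨hGg (Finset.mem_sdiff.1 hz).1, (Finset.mem_sdiff.1 hz).2⟩
  have hwF : w ∈ gr M \ F := Finset.mem_sdiff.2 ⟨(Finset.mem_sdiff.1 hw).1,
    fun h => (Finset.mem_sdiff.1 hw).2 (hB₀G h)⟩
  have hzw : z ≠ w := fun h => (Finset.mem_sdiff.1 hw).2 (h ▸ (Finset.mem_sdiff.1 hz).1)
  -- gr M ∖ F = {z, w}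
  have hpair : gr M \ F = {z, w} := by
    symm
    apply Finset.eq_of_subset_of_card_le
    · intro x hx
      rw [Finset.mem_insert, Finset.mem_singleton] at hx
      rcases hx with rfl | rfl
      · exact hzF
      · exact hwF
    · rw [h2, Finset.card_pair hzw]
  by_contra hne
  -- B ⊄ F, so z ∈ B
  have hBF : ¬ B ⊆ F := by
    intro hBF
    apply hne
    apply flatsQ_eq_of_subset hBq hFq
    rw [← Finset.coe_subset, coe_clF]
    have : (B : Set α) ⊆ (F : Set α) := by exact_mod_cast hBF
    exact (M.closure_subset_closure this).trans (by rw [hF, coe_clF, M.closure_closure])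
  obtain ⟨y, hyB, hyF⟩ := Finset.not_subset.1 hBF
  have hyG : y ∈ G := hBG (subset_clF hB hyB)
  have hyz : y = z := by
    have : y ∈ gr M \ F := Finset.mem_sdiff.2 ⟨hGg hyG, hyF⟩
    rw [hpair, Finset.mem_insert, Finset.mem_singleton] at this
    rcases this with h | h
    · exact h
    · exact absurd (h ▸ hyG) (Finset.mem_sdiff.1 hw).2
  -- E ∖ B ⊆ insert w F, which has rank ≤ q + 1
  have hsub : (gr M \ B : Finset α) ⊆ insert w F := by
    intro x hx
    rw [Finset.mem_sdiff] at hx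
    by_cases hxF : x ∈ F
    · exact Finset.mem_insert_of_mem hxF
    · have : x ∈ gr M \ F := Finset.mem_sdiff.2 ⟨hx.1, hxF⟩
      rw [hpair, Finset.mem_insert, Finset.mem_singleton] at this
      rcases this with rfl | rfl
      · exact absurd (hyz ▸ hyB) hx.2
      · exact Finset.mem_insert_self _ _
  have hr : M.eRk ((gr M \ B : Finset α) : Set α) ≤ ((q + 1 : ℕ) : ℕ∞) := by
    calc M.eRk ((gr M \ B : Finset α) : Set α) ≤ M.eRk ((insert w F : Finset α) : Set α) :=
          M.eRk_mono (by exact_mod_cast hsub)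
      _ ≤ M.eRk (F : Set α) + 1 := by rw [Finset.coe_insert]; exact M.eRk_insert_le_add_one _ _
      _ = ((q + 1 : ℕ) : ℕ∞) := by rw [(mem_flatsQ.1 hFq).2.2]; push_cast; rfl
  rw [(mem_Uq.1 hB).2.2] at hr
  have : q + 2 ≤ q + 1 := by exact_mod_cast hr
  omega

/-- **The local form at a flat carrying a hyperplane with two elements outside.** -/
theorem localShadowHall_of_exists_two {q : ℕ} {G : Finset α} (hG : G ∈ flatsQ M (q + 1))
    (hex : ∃ B₀ ∈ Uq M (q + 2) q, clF M B₀ ⊆ G ∧ (gr M \ clF M B₀).card = 2) :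
    LocalShadowHall M q G := by
  obtain ⟨B₀, hB₀, hB₀G, h2⟩ := hex
  exact localShadowHall_of_single hG (F := clF M B₀)
    (fun B hB hBG => clF_eq_of_card_compl_two hG hB₀ hB₀G h2 hB hBG)

/-! ## The diagonal `q = 1` -/

/-- **The local form holds at every line of every finite matroid** (`q = 1`): a carrying hyperplane is either
thin (`|E ∖ F| ≥ 3`) or has exactly two elements outside. -/
theorem localShadowHall_one {G : Finset α} (hG : G ∈ flatsQ M (1 + 1)) : LocalShadowHall M 1 G := by
  classical
  rcases em (∃ B₀ ∈ Uq M (1 + 2) 1, clF M B₀ ⊆ G ∧ (gr M \ clF M B₀).card = 2) with hex | hnex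
  · exact localShadowHall_of_exists_two hG hex
  · apply localShadowHall_of_thin hG
    intro B hB hBG
    have h2 := two_le_card_compl_clF hB
    by_contra hlt
    exact hnex ⟨B, hB, hBG, by omega⟩

/-- **THE DIAGONAL SHADOW FORM OF C-025 AT `q = 1`, for every finite matroid**: every sub-family `𝒜` of the bottom
sets `Uq M 3 1` has at least `Φ(3, 1) · #𝒜 = (3/2) · #𝒜` middle-level sets above it. -/
theorem shadowHall_three_one (M : Matroid α) [M.Finite] : ShadowHall M 3 1 (phiK 3 1) := by
  have h := shadowHall_of_local (M := M) (q := 1) (fun G hG => localShadowHall_one hG)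
  rw [GenQ.phiK_succ_succ 1]
  exact h

end PercRepro.Shadow
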